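import Literature.MathematicalPhysics.QuantumFieldTheory.Balaban1983to89.B10Eq44AvgRegularity
import Literature.MathematicalPhysics.QuantumFieldTheory.Balaban1983to89.B8Ineq132

/-!
# `Balaban1983to89.B10Eq44OnDomain` — T. Bałaban, *Ultraviolet stability of three-dimensional lattice pure gauge field
# theories*, Commun. Math. Phys. **102** (1985) 255–275 [Balaban1985UV3]: the sentence before (44) p. 267 with its
# printed DOMAIN CLAUSES — *"on `Ω_k`"* (a union of blocks, (39)) and *"for `p′ ⊂ Ω_k^{(j)}`"* — for the concrete
# `j`-fold block average of [4] on `ℤ^d` (theorems only)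

statement-level skeleton of published theorems with citation tags; proofs where landed; nothing here is a claim
about the Yang–Mills mass gap

PDF held: `paper:balaban1985-cmp102-uv-stability-3d` (journal page = PDF page + 254); p. 267 (PDF 13) read from the
render `pub-balaban/b2b-balaban-ref1/pages/1985-cmp102-uv-stability-3d/1985-cmp102-uv-stability-3d-p013-x2.png`, p. 266
(PDF 12) from the held text.  "[4]" = [Balaban1985Averaging] (cell paper B7).

WHAT IS REPRODUCED (mega-formalization `lit-balaban`, HOME `run/shared/lean/pub/lit-balaban/`, Phase-2 proof seat
`p29` gen 5, unit `lit-balaban-p29`; companion of `B10Eq44AvgRegularity` for SKELETON row `B10.Eq44` of reader r07's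
`ROWS-B10.md`).  THE PRINTED TEXT (p. 267): *"The configuration `U_k` satisfies the following regularity condition on
`Ω_k`: `|U_k(∂p) − 1| < 2L²B₃g_{k−1}p(g_{k−1})η²`. This implies the condition `|Ū_k^j(∂p′) − 1| <
4L²B₃g_{k−1}p(g_{k−1})(L^jη)²` for `p′ ⊂ Ω_k^{(j)}`"*; (39) p. 266: *"`Ω_j` is a union of big blocks of the size
`M₁L^jη`"*; (1) of [4] p. 17: `Ω^{(j)} = Ω ∩ L^jηZ^d`.  `B10Eq44AvgRegularity.reg44_avg_local` proved the implication with
the hypothesis placed on the four `j`-blocks at the corners of `p′` (the locality of [4] p. 26).  THIS FILE supplies the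
two printed domain clauses literally: for a set `Ω ⊂ ηℤ^d ≅ ℤ^d` which is a union of `j`-blocks (`hΩ`: membership of a
fine site is decided by the corner of its `j`-block — implied by (39), big blocks of size `M₁L^kη` being unions of
`j`-blocks for `j ≤ k`), the regularity ASSUMED ONLY FOR THE PLAQUETTES `p ⊂ Ω` (all four vertices in `Ω`) and a
plaquette `p′` of the `L^jη`-lattice WITH ITS FOUR VERTICES IN `Ω` (`p′ ⊂ Ω^{(j)}`): the four `j`-blocks at the
corners of `p′` lie in `Ω` (`mem_of_inBox_corners`), so the box hypothesis of `reg44_avg_local` holds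
(`pdevOn_corners_lt_of_onDomain`, via r05's `B8Ineq132.pdevOn_lt_of_forall`) and *"This implies the condition …"*
follows: `reg44_avg_onDomain` (`AvgClosed` gauge groups, e.g. `U(N)`), `reg44_avg_onDomain_at` (groups closed at
radius `t`, e.g. `SU(N)`), `reg44_avg_onDomain_unitaryGroup` (`G = U(N) ⊂ M_N(ℂ)`, operator norm).
MODEL NOTES.  (M1)–(M5) of `B10Eq44AvgRegularity` (lattices read on `ℤ^d`: `p′ = (z; μ, ν)` has the fine-lattice
vertices `L^jz`, `L^j(z + e_μ)`, `L^j(z + e_ν)`, `L^j(z + e_μ + e_ν)` = `B7Prop1Local.loK L j ·`; `U_k` any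
configuration; explicit smallness; `AvgClosed`/`AvgClosedAt` gauge groups; any `d`, `L ≥ 2`).  (M8) "`p ⊂ Ω_k`" is
read as: all four vertices of the unit plaquette `p` lie in `Ω_k`; "union of blocks" as the `j`-block saturation
`hΩ` (print's big blocks are `M₁L^k`-blocks; only `j`-block saturation is used).  No `sorry`, no definitions, no new
named facts; axioms `propext`, `Classical.choice`, `Quot.sound`.
-/

noncomputable section

open scoped BigOperators
open NormedSpace Finset

namespace Literature.MathematicalPhysics.QuantumFieldTheory.Balaban1983to89.B10Eq44OnDomain

open B7Prop1Explicit B7Prop2Explicit B7Prop2SpecialUnitary B7Prop1Local B10Eq44AvgRegularity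
open B8Ineq132 (Under pdevOn_lt_of_forall)

export B7Prop1Explicit (Site) -- the `ℤ^d` sites (the torus `Site` of `Setup.lean` would shadow them)

variable {d : ℕ}

/-! ## §1 Geometry: the box under `p′` consists of the four `j`-blocks at its vertices -/

/-- A fine site `x` of the box `[L^jz, L^jz + (L^j − 1)𝟙 + L^je_μ + L^je_ν]` lies in the `j`-block `B^j(w)` of a
level-`j` site `w` with `z ≤ w ≤ z + e_μ + e_ν` coordinatewise — one of the four vertices of `p′ = (z; μ, ν)`
((2) of [4]: `B^j(w) = {x : w_i ≤ x_i < w_i + L^jη}`). [cite: Balaban1985Averaging, (2) p.17] -/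
theorem exists_under_of_inBox {L : ℕ} (hL : 1 ≤ L) {j : ℕ} {z x : Site d} {μ ν : Fin d}
    (hx : InBox (loK L j z) (plaqHiK L j z μ ν) x) :
    ∃ w : Site d, Under L j w x ∧ ∀ i, z i ≤ w i ∧ w i ≤ z i + (if i = μ ∨ i = ν then 1 else 0) := by
  have hP : (0 : ℤ) < (L : ℤ) ^ j := by
    have : (1 : ℤ) ≤ (L : ℤ) := by exact_mod_cast hL
    positivity
  refine ⟨fun i => x i / (L : ℤ) ^ j, fun i => ⟨Int.mul_ediv_self_le hP.ne', ?_⟩, fun i => ⟨?_, ?_⟩⟩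
  · have h := Int.lt_mul_ediv_self_add (x := x i) hP
    linarith
  · show z i ≤ x i / (L : ℤ) ^ j
    have h := (hx i).1
    simp only [loK] at h
    exact Int.le_ediv_of_mul_le hP (by linarith)
  · show x i / (L : ℤ) ^ j ≤ z i + (if i = μ ∨ i = ν then 1 else 0)
    have h := (hx i).2
    simp only [plaqHiK] at h
    have hlt : x i < (z i + (if i = μ ∨ i = ν then 1 else 0) + 1) * (L : ℤ) ^ j := by
      split_ifs at h ⊢ <;> nlinarith
    have := Int.ediv_lt_of_lt_mul hP hlt
    omega

/-- **The four `j`-blocks at the vertices of `p′` lie in `Ω`**: if `Ω` is a union of `j`-blocks (membership decided by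
the block's corner `L^jw`) and the four vertices `L^jw`, `z ≤ w ≤ z + e_μ + e_ν`, of `p′ = (z; μ, ν)` lie in `Ω`
(*"`p′ ⊂ Ω_k^{(j)}`"*), then every fine site of the box `[L^jz, L^jz + (L^j − 1)𝟙 + L^je_μ + L^je_ν]` lies in `Ω`.
[cite: Balaban1985UV3, (39) p.266, p.267 (sentence before (44))] -/
theorem mem_of_inBox_corners {L : ℕ} (hL : 1 ≤ L) {Ω : Set (Site d)} {j : ℕ}
    (hΩ : ∀ w x : Site d, Under L j w x → (x ∈ Ω ↔ loK L j w ∈ Ω)) {z : Site d} {μ ν : Fin d}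
    (hp : ∀ w : Site d, (∀ i, z i ≤ w i ∧ w i ≤ z i + (if i = μ ∨ i = ν then 1 else 0)) → loK L j w ∈ Ω)
    {x : Site d} (hx : InBox (loK L j z) (plaqHiK L j z μ ν) x) : x ∈ Ω := by
  obtain ⟨w, hwx, hw⟩ := exists_under_of_inBox hL hx
  exact (hΩ w x hwx).2 (hp w hw)

/-! ## §2 The box hypothesis of `reg44_avg_local` from the printed clauses -/

section OnDomain

variable {𝔸 : Type*} [NormedRing 𝔸] [NormOneClass 𝔸] [NormedAlgebra ℂ 𝔸] [CompleteSpace 𝔸]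

omit [NormOneClass 𝔸] [NormedAlgebra ℂ 𝔸] [CompleteSpace 𝔸] in
/-- **"on `Ω_k`" + "`p′ ⊂ Ω_k^{(j)}`" ⇒ the box hypothesis:** if `|U(∂p) − 1| < δ` for every unit plaquette `p` with
its four vertices in `Ω` (`Ω` a union of `j`-blocks), and the four vertices of `p′ = (z; μ, ν)` lie in `Ω`, then
`sup |U(∂p) − 1| < δ` over the unit plaquettes of the box under the four `j`-blocks at the vertices of `p′`
(`B7Prop1Local.pdevOn`; strictness by finiteness, `B8Ineq132.pdevOn_lt_of_forall`). [cite: Balaban1985UV3, p.267 (sentence before (44))] -/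
theorem pdevOn_corners_lt_of_onDomain {L : ℕ} (hL : 1 ≤ L) {Ω : Set (Site d)} {j : ℕ}
    (hΩ : ∀ w x : Site d, Under L j w x → (x ∈ Ω ↔ loK L j w ∈ Ω)) {U : Site d → Fin d → 𝔸ˣ} {δ : ℝ}
    (hδ : 0 < δ)
    (hreg : ∀ (x : Site d) (κ κ' : Fin d), κ ≠ κ' → x ∈ Ω → x + e κ ∈ Ω → x + e κ' ∈ Ω → x + e κ + e κ' ∈ Ω →
      ‖((hol U x (plaqWord κ κ') : 𝔸ˣ) : 𝔸) - 1‖ < δ)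
    {z : Site d} {μ ν : Fin d}
    (hp : ∀ w : Site d, (∀ i, z i ≤ w i ∧ w i ≤ z i + (if i = μ ∨ i = ν then 1 else 0)) → loK L j w ∈ Ω) :
    pdevOn (loK L j z) (plaqHiK L j z μ ν) U < δ := by
  refine pdevOn_lt_of_forall hδ fun x κ κ' hx hx2 => ?_
  rcases eq_or_ne κ κ' with rfl | hne
  · rw [hol_plaqWord_self, Units.val_one, sub_self, norm_zero]; exact hδ
  have mem : ∀ {y : Site d}, InBox (loK L j z) (plaqHiK L j z μ ν) y → y ∈ Ω :=
    fun hy => mem_of_inBox_corners hL hΩ hp hy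
  have hb1 : InBox (loK L j z) (plaqHiK L j z μ ν) (x + e κ) :=
    inBox_of_between hx hx2 fun i => Or.inl (by simp only [add_e_apply]; split_ifs <;> omega)
  have hb2 : InBox (loK L j z) (plaqHiK L j z μ ν) (x + e κ') :=
    inBox_of_between hx hx2 fun i => Or.inl (by simp only [add_e_apply]; split_ifs <;> omega)
  exact hreg x κ κ' hne (mem hx) (mem hb1) (mem hb2) (mem hx2)

/-! ## §3 The sentence before (44) with both printed domain clauses -/

/-- **p. 267, the sentence before (44), ON `Ω_k` AND FOR `p′ ⊂ Ω_k^{(j)}` (gauge group closed under (42) at radius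
`t`):** `Ω ⊂ ηℤ^d` a union of `j`-blocks ((39)), `U_k` a `G`-valued configuration with `|U_k(∂p) − 1| < 2L²B₃εη²` for
the plaquettes `p ⊂ Ω` (`ε` = `g_{k−1}p(g_{k−1})`), [4] Prop. 2's smallness for `α₀ = 2L²B₃ε`, `j ≤ k`, and `p′ =
(z; μ, ν)` a plaquette of the `L^jη`-lattice with its four vertices in `Ω` ⟹ `|Ū_k^j(∂p′) − 1| < 4L²B₃ε(L^jη)²`.
[cite: Balaban1985UV3, p.267 (sentence before (44))] -/
theorem reg44_avg_onDomain_at (L : ℕ) (hL : 2 ≤ L) {G : Subgroup 𝔸ˣ} {t : ℝ} (hG : AvgClosedAt d t L G) (k : ℕ)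
    (U : Site d → Fin d → 𝔸ˣ) (hU : ∀ x κ, U x κ ∈ G) {B₃ ε : ℝ} (hpos : 0 < (L : ℝ) ^ 2 * B₃ * ε)
    (hα3 : C0 d * (2 * (L : ℝ) ^ 2 * B₃ * ε) ≤ 1 / 3) (hα2 : 2 * (2 * (L : ℝ) ^ 2 * B₃ * ε) ≤ c2' d L)
    (hαt : 32 * ((d : ℝ) + 1) * (d + 4) * (L : ℝ) ^ 2 * (2 * (L : ℝ) ^ 2 * B₃ * ε) ≤ t)
    {Ω : Set (Site d)} {j : ℕ} (hj : j ≤ k) (hΩ : ∀ w x : Site d, Under L j w x → (x ∈ Ω ↔ loK L j w ∈ Ω))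
    (hreg : ∀ (x : Site d) (κ κ' : Fin d), κ ≠ κ' → x ∈ Ω → x + e κ ∈ Ω → x + e κ' ∈ Ω → x + e κ + e κ' ∈ Ω →
      ‖((hol U x (plaqWord κ κ') : 𝔸ˣ) : 𝔸) - 1‖ < 2 * (L : ℝ) ^ 2 * B₃ * ε * (((L : ℝ) ^ k)⁻¹) ^ 2)
    (z : Site d) (μ ν : Fin d)
    (hp : ∀ w : Site d, (∀ i, z i ≤ w i ∧ w i ≤ z i + (if i = μ ∨ i = ν then 1 else 0)) → loK L j w ∈ Ω) :
    ‖((hol (avgIter L U j) z (plaqWord μ ν) : 𝔸ˣ) : 𝔸) - 1‖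
      < 4 * (L : ℝ) ^ 2 * B₃ * ε * ((L : ℝ) ^ j * ((L : ℝ) ^ k)⁻¹) ^ 2 := by
  have hL1 : 1 ≤ L := le_trans (by norm_num) hL
  have hLr : (2 : ℝ) ≤ L := by exact_mod_cast hL
  have hδ : 0 < 2 * (L : ℝ) ^ 2 * B₃ * ε * (((L : ℝ) ^ k)⁻¹) ^ 2 := by
    have hL0 : (0 : ℝ) < L := by linarith
    have h := mul_pos hpos (pow_pos (inv_pos.mpr (pow_pos hL0 k)) 2)
    linarith
  exact reg44_avg_local_at L hL hG k U hU hpos hα3 hα2 hαt hj z μ ν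
    (pdevOn_corners_lt_of_onDomain hL1 hΩ hδ hreg hp)

/-- **p. 267, the sentence before (44), ON `Ω_k` AND FOR `p′ ⊂ Ω_k^{(j)}`**, `AvgClosed` gauge group (e.g. `U(N)`).
[cite: Balaban1985UV3, p.267 (sentence before (44))] -/
theorem reg44_avg_onDomain (L : ℕ) (hL : 2 ≤ L) {G : Subgroup 𝔸ˣ} (hG : AvgClosed d L G) (k : ℕ)
    (U : Site d → Fin d → 𝔸ˣ) (hU : ∀ x κ, U x κ ∈ G) {B₃ ε : ℝ} (hpos : 0 < (L : ℝ) ^ 2 * B₃ * ε)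
    (hα3 : C0 d * (2 * (L : ℝ) ^ 2 * B₃ * ε) ≤ 1 / 3) (hα2 : 2 * (2 * (L : ℝ) ^ 2 * B₃ * ε) ≤ c2' d L)
    {Ω : Set (Site d)} {j : ℕ} (hj : j ≤ k) (hΩ : ∀ w x : Site d, Under L j w x → (x ∈ Ω ↔ loK L j w ∈ Ω))
    (hreg : ∀ (x : Site d) (κ κ' : Fin d), κ ≠ κ' → x ∈ Ω → x + e κ ∈ Ω → x + e κ' ∈ Ω → x + e κ + e κ' ∈ Ω →
      ‖((hol U x (plaqWord κ κ') : 𝔸ˣ) : 𝔸) - 1‖ < 2 * (L : ℝ) ^ 2 * B₃ * ε * (((L : ℝ) ^ k)⁻¹) ^ 2)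
    (z : Site d) (μ ν : Fin d)
    (hp : ∀ w : Site d, (∀ i, z i ≤ w i ∧ w i ≤ z i + (if i = μ ∨ i = ν then 1 else 0)) → loK L j w ∈ Ω) :
    ‖((hol (avgIter L U j) z (plaqWord μ ν) : 𝔸ˣ) : 𝔸) - 1‖
      < 4 * (L : ℝ) ^ 2 * B₃ * ε * ((L : ℝ) ^ j * ((L : ℝ) ^ k)⁻¹) ^ 2 := by
  have hL1 : (1 : ℝ) ≤ L := by exact_mod_cast le_trans (by norm_num) hL
  have hq : 32 * ((d : ℝ) + 1) * (d + 4) * (L : ℝ) ^ 2 * (2 * (L : ℝ) ^ 2 * B₃ * ε) ≤ 1 / 4 := by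
    have hden : (0 : ℝ) < 512 * ((d : ℝ) + 1) * (d + 4) * (L : ℝ) ^ 2 := by positivity
    have h1 : 2 * (2 * (L : ℝ) ^ 2 * B₃ * ε) ≤ 1 / (512 * ((d : ℝ) + 1) * (d + 4) * (L : ℝ) ^ 2) := hα2
    rw [le_div_iff₀ hden] at h1
    linarith
  exact reg44_avg_onDomain_at L hL (avgClosedAt_of_avgClosed hG le_rfl) k U hU hpos hα3 hα2 hq hj hΩ hreg z μ ν hp

end OnDomain

section Matrices

open scoped Matrix.Norms.L2Operator

/-- **p. 267, the sentence before (44), ON `Ω_k` AND FOR `p′ ⊂ Ω_k^{(j)}`, for `G = U(N) ⊂ M_N(ℂ)`, `N ≥ 1`,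
operator norm (19) of [4].** [cite: Balaban1985UV3, p.267 (sentence before (44))] -/
theorem reg44_avg_onDomain_unitaryGroup (N : ℕ) [NeZero N] (L : ℕ) (hL : 2 ≤ L) (k : ℕ)
    (U : Site d → Fin d → (Matrix (Fin N) (Fin N) ℂ)ˣ)
    (hU : ∀ x κ, U x κ ∈ unitaryUnits (Matrix (Fin N) (Fin N) ℂ)) {B₃ ε : ℝ}
    (hpos : 0 < (L : ℝ) ^ 2 * B₃ * ε) (hα3 : C0 d * (2 * (L : ℝ) ^ 2 * B₃ * ε) ≤ 1 / 3)
    (hα2 : 2 * (2 * (L : ℝ) ^ 2 * B₃ * ε) ≤ c2' d L) {Ω : Set (Site d)} {j : ℕ} (hj : j ≤ k)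
    (hΩ : ∀ w x : Site d, Under L j w x → (x ∈ Ω ↔ loK L j w ∈ Ω))
    (hreg : ∀ (x : Site d) (κ κ' : Fin d), κ ≠ κ' → x ∈ Ω → x + e κ ∈ Ω → x + e κ' ∈ Ω → x + e κ + e κ' ∈ Ω →
      ‖((hol U x (plaqWord κ κ') : (Matrix (Fin N) (Fin N) ℂ)ˣ) : Matrix (Fin N) (Fin N) ℂ) - 1‖
        < 2 * (L : ℝ) ^ 2 * B₃ * ε * (((L : ℝ) ^ k)⁻¹) ^ 2)
    (z : Site d) (μ ν : Fin d)
    (hp : ∀ w : Site d, (∀ i, z i ≤ w i ∧ w i ≤ z i + (if i = μ ∨ i = ν then 1 else 0)) → loK L j w ∈ Ω) :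
    ‖((hol (avgIter L U j) z (plaqWord μ ν) : (Matrix (Fin N) (Fin N) ℂ)ˣ) : Matrix (Fin N) (Fin N) ℂ) - 1‖
      < 4 * (L : ℝ) ^ 2 * B₃ * ε * ((L : ℝ) ^ j * ((L : ℝ) ^ k)⁻¹) ^ 2 := by
  letI : CStarAlgebra (Matrix (Fin N) (Fin N) ℂ) := {}
  exact reg44_avg_onDomain L hL (avgClosed_unitaryUnits d L) k U hU hpos hα3 hα2 hj hΩ hreg z μ ν hp

end Matrices

end Literature.MathematicalPhysics.QuantumFieldTheory.Balaban1983to89.B10Eq44OnDomain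

end
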